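import Summits.PneNP.PneNP.Theorems.ChebyshevTracialDesignSaturatedSubsets
import HarnessLib

/-!
# Cell pnp-psdrank, route `ChebyshevTracialDesign`: binomial-moment column sums of a harmonic layer —
# the exact singular profile of the saturation kernels `E^{(a)} = 𝒰 ∘ B_{2a}` at every level

Harmonic backbone, brick 6 (MEMO-7 §1 (1f) in the `E`-basis, all levels). For a perfect matching (partner involution
`π`) and the binomial-moment kernel `E^{(a)}(U,M) = C(e(U,M), a) = #{V ⊆ U : |V| = 2a, V M-saturated}`
(`…SaturatedSubsets`, p441567), the column sums of the layer function `zeta p` (p Johnson-harmonic of degree k) over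
the `t`-subsets are, EXACTLY and for every `a`:
* `momentSum_zeta_eq_zero_of_odd` : `Σ_{|U| = t} C(e_π(U), a) · zeta p (U) = 0` for odd `k`;
* `momentSum_zeta_eq_of_even` : `= C(n − 2a − 2κ, t − 2a) · C(n/2 − 2κ, a − κ) · Σ_{T closed, |T| = 2κ} p_T` for
  `k = 2κ` (`4κ ≤ n`, `κ ≤ a`, `2a ≤ t`) — the `E`-basis singular profile `s_κ(a) = C(n−2a−2κ, t−2a)·C(N−2κ, a−κ)` of
  MEMO-7 (verified entrywise at n ≤ 12), rank one in `a` with the same matching-side functional `Π_p(M)`.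
Ingredients: `E^{(a)} = 𝒰 ∘ B_{2a}` (`momentSum_eq_closedSum_supersets`: swap through the closed `2a`-subsets), the
ITERATED slice ladder `Σ_{U ⊇ V, |U| = |V| + j} zeta p (U) = C(n − |V| − k, j) · zeta p (V)` (`sum_supersets_zeta_iter`,
from p437052's one-step version by double counting), and the `B`-scalar (p438743). Since Rothvoß's level kernels are the
binomial inverse `A_{t−2e} = Σ_{a ≥ e} (−1)^{a−e} C(a,e) E^{(a)}` [cite: Rothvoss2017, §2 (PDF p. 6)], this is the exact
bi-mode expansion (★) up to that inversion [cite: GodsilMeagher2015, §15.2 (perfect matching scheme)].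
WHAT THIS IS NOT: the inversion to the `A`-basis and the eigenvalue counts; nothing on psd rank. Supports crux
stmt-PneNP-19878.
-/

set_option linter.dupNamespace false -- `Summit.PneNP.PneNP.…`: summit = sub-problem (D-0017)

noncomputable section

namespace Summit.PneNP.PneNP.Theorems.ChebyshevTracialDesignBinomialMomentSums

open Finset Literature.Combinatorics.AssociationSchemes Literature.Combinatorics.AssociationSchemes.JohnsonHarmonics
open Summit.PneNP.PneNP.Theorems.ChebyshevTracialDesignSliceLadders
open Summit.PneNP.PneNP.Theorems.ChebyshevTracialDesignMatchingClosedSums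
open Summit.PneNP.PneNP.Theorems.ChebyshevTracialDesignSaturatedSubsets

variable {n : ℕ}

/-! ### §1 The iterated slice ladder -/

/-- Double counting between two consecutive superset slices: each `U ⊇ V` with `|U| = |V| + j + 1` contains exactly
`j + 1` sets `W` with `V ⊆ W ⊆ U`, `|W| = |V| + j`. -/
theorem sum_supersets_succ_eq (f : Finset (Fin n) → ℝ) (V : Finset (Fin n)) (j : ℕ) :
    ∑ W ∈ (powersetCard (V.card + j) (univ : Finset (Fin n))).filter (fun W => V ⊆ W),
        ∑ U ∈ (powersetCard (W.card + 1) (univ : Finset (Fin n))).filter (fun U => W ⊆ U), f U =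
      ((j : ℝ) + 1) * ∑ U ∈ (powersetCard (V.card + j + 1) (univ : Finset (Fin n))).filter (fun U => V ⊆ U), f U := by
  classical
  have hinner : ∀ W ∈ (powersetCard (V.card + j) (univ : Finset (Fin n))).filter (fun W => V ⊆ W),
      ∑ U ∈ (powersetCard (W.card + 1) (univ : Finset (Fin n))).filter (fun U => W ⊆ U), f U =
      ∑ U ∈ (powersetCard (V.card + j + 1) (univ : Finset (Fin n))).filter (fun U => W ⊆ U), f U := by
    intro W hW
    rw [(mem_powersetCard.1 (mem_filter.1 hW).1).2]
  rw [sum_congr rfl hinner,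
    sum_comm' (t' := (powersetCard (V.card + j + 1) (univ : Finset (Fin n))).filter (fun U => V ⊆ U))
      (s' := fun U => (powersetCard (V.card + j) U).filter (fun W => V ⊆ W))
      (h := fun W U => by
        simp only [mem_filter, mem_powersetCard, subset_univ, true_and]
        constructor
        · rintro ⟨⟨hWc, hVW⟩, hUc, hWU⟩
          exact ⟨⟨⟨hWU, hWc⟩, hVW⟩, hUc, hVW.trans hWU⟩
        · rintro ⟨⟨⟨hWU, hWc⟩, hVW⟩, hUc, -⟩
          exact ⟨⟨hWc, hVW⟩, hUc, hWU⟩),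
    mul_sum]
  refine sum_congr rfl fun U hU => ?_
  simp only [mem_filter, mem_powersetCard, subset_univ, true_and] at hU
  rw [sum_const, nsmul_eq_mul, card_filter_powersetCard_superset hU.2 (by omega), hU.1]
  have : (V.card + j + 1 - V.card).choose (V.card + j - V.card) = j + 1 := by
    rw [show V.card + j + 1 - V.card = j + 1 by omega, show V.card + j - V.card = j by omega]
    exact Nat.choose_succ_self_right j
  rw [this]; push_cast; ring

/-- **Iterated slice ladder.** For `p` harmonic of degree `k` and any `V`:
`Σ_{U ⊇ V, |U| = |V| + j} zeta p (U) = C(n − |V| − k, j) · zeta p (V)` (as a real product formula: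
`j! · Σ = Π_{i<j} (n − |V| − k − i) · zeta p (V)`). -/
theorem sum_supersets_zeta_iter {k : ℕ} {p : Finset (Fin n) → ℝ} (hp : IsHarmonic k p) (V : Finset (Fin n)) (j : ℕ) :
    ((j.factorial : ℕ) : ℝ) * ∑ U ∈ (powersetCard (V.card + j) (univ : Finset (Fin n))).filter (fun U => V ⊆ U),
        zeta p U = (∏ i ∈ range j, ((n : ℝ) - V.card - k - i)) * zeta p V := by
  induction j with
  | zero =>
    simp only [Nat.factorial_zero, Nat.cast_one, one_mul, add_zero, range_zero, prod_empty]
    -- the only superset of size `|V|` is `V`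
    have : (powersetCard V.card (univ : Finset (Fin n))).filter (fun U => V ⊆ U) = {V} := by
      ext U
      simp only [mem_filter, mem_powersetCard, subset_univ, true_and, mem_singleton]
      constructor
      · rintro ⟨hc, hVU⟩; exact (eq_of_subset_of_card_le hVU hc.le).symm
      · rintro rfl; exact ⟨rfl, subset_refl _⟩
    rw [this, sum_singleton]
  | succ j ih =>
    -- `(j+1)! Σ_{|U| = |V|+j+1} = j! · (j+1) Σ = j! · Σ_W Σ_{U ⊇ W}` and the inner sums are one raising step
    have hstep := sum_supersets_succ_eq (fun U => zeta p U) V j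
    have hinner : ∀ W ∈ (powersetCard (V.card + j) (univ : Finset (Fin n))).filter (fun W => V ⊆ W),
        ∑ U ∈ (powersetCard (W.card + 1) (univ : Finset (Fin n))).filter (fun U => W ⊆ U), zeta p U =
        ((n : ℝ) - (V.card + j : ℕ) - k) * zeta p W := by
      intro W hW
      rw [sum_supersets_zeta hp W, (mem_powersetCard.1 (mem_filter.1 hW).1).2]
    rw [sum_congr rfl hinner, ← mul_sum] at hstep
    have hj1 : ((j : ℝ) + 1) ≠ 0 := by positivity
    -- from `hstep`: Σ_{j+1} = (n - |V| - j - k) Σ_j / (j+1)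
    have hsol : ∑ U ∈ (powersetCard (V.card + j + 1) (univ : Finset (Fin n))).filter (fun U => V ⊆ U), zeta p U =
        ((n : ℝ) - (V.card + j : ℕ) - k) / ((j : ℝ) + 1) *
          ∑ W ∈ (powersetCard (V.card + j) (univ : Finset (Fin n))).filter (fun W => V ⊆ W), zeta p W := by
      field_simp
      linarith [hstep]
    have e1 : (((j + 1).factorial : ℕ) : ℝ) = ((j : ℝ) + 1) * (j.factorial : ℝ) := by
      rw [Nat.factorial_succ]; push_cast; ring
    rw [show V.card + (j + 1) = V.card + j + 1 by ring, prod_range_succ, hsol, e1]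
    calc ((j : ℝ) + 1) * (j.factorial : ℝ) * (((n : ℝ) - (V.card + j : ℕ) - k) / ((j : ℝ) + 1) *
          ∑ W ∈ (powersetCard (V.card + j) (univ : Finset (Fin n))).filter (fun W => V ⊆ W), zeta p W)
        = ((n : ℝ) - (V.card + j : ℕ) - k) * (((j.factorial : ℕ) : ℝ) *
            ∑ W ∈ (powersetCard (V.card + j) (univ : Finset (Fin n))).filter (fun W => V ⊆ W), zeta p W) := by
          field_simp
      _ = ((n : ℝ) - (V.card + j : ℕ) - k) * ((∏ i ∈ range j, ((n : ℝ) - V.card - k - i)) * zeta p V) := by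
          rw [ih]
      _ = (∏ i ∈ range j, ((n : ℝ) - V.card - k - i)) * ((n : ℝ) - V.card - k - (j : ℕ)) * zeta p V := by
          push_cast; ring

/-! ### §2 Binomial-moment column sums -/

/-- **`E^{(a)} = 𝒰 ∘ B_{2a}`**: weighting `t`-sets by their number of closed `2a`-subsets is summing over the closed
`2a`-sets and then over their `t`-supersets. -/
theorem momentSum_eq_closedSum_supersets {π : Fin n → Fin n} (hinv : ∀ x, π (π x) = x) (hfix : ∀ x, π x ≠ x)
    (f : Finset (Fin n) → ℝ) (t a : ℕ) :
    ∑ U ∈ powersetCard t (univ : Finset (Fin n)),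
        ((((U.filter fun x => x < π x ∧ π x ∈ U).card).choose a : ℕ) : ℝ) * f U =
      ∑ V ∈ (powersetCard (2 * a) (univ : Finset (Fin n))).filter (fun V => ∀ x ∈ V, π x ∈ V),
        ∑ U ∈ (powersetCard t (univ : Finset (Fin n))).filter (fun U => V ⊆ U), f U := by
  classical
  rw [sum_comm' (t' := powersetCard t (univ : Finset (Fin n)))
    (s' := fun U => (powersetCard (2 * a) U).filter (fun V => ∀ x ∈ V, π x ∈ V))
    (h := fun V U => by
      simp only [mem_filter, mem_powersetCard, subset_univ, true_and]
      tauto)]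
  refine sum_congr rfl fun U _ => ?_
  rw [sum_const, nsmul_eq_mul, card_closed_subsets_eq_choose hinv hfix U a]

/-- **Odd degrees: binomial-moment column sums vanish.** -/
theorem momentSum_zeta_eq_zero_of_odd {π : Fin n → Fin n} (hinv : ∀ x, π (π x) = x) (hfix : ∀ x, π x ≠ x)
    {k : ℕ} (hk : Odd k) {p : Finset (Fin n) → ℝ} (hp : IsHarmonic k p) {t a : ℕ} (hat : 2 * a ≤ t) :
    ∑ U ∈ powersetCard t (univ : Finset (Fin n)),
        ((((U.filter fun x => x < π x ∧ π x ∈ U).card).choose a : ℕ) : ℝ) * zeta p U = 0 := by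
  rw [momentSum_eq_closedSum_supersets hinv hfix]
  obtain ⟨j, hj⟩ : ∃ j, t = 2 * a + j := ⟨t - 2 * a, by omega⟩
  have hinner : ∀ V ∈ (powersetCard (2 * a) (univ : Finset (Fin n))).filter (fun V => ∀ x ∈ V, π x ∈ V),
      ∑ U ∈ (powersetCard t (univ : Finset (Fin n))).filter (fun U => V ⊆ U), zeta p U =
      ((∏ i ∈ range j, ((n : ℝ) - (2 * a : ℕ) - k - i)) / (j.factorial : ℝ)) * zeta p V := by
    intro V hV
    have hVc : V.card = 2 * a := (mem_powersetCard.1 (mem_filter.1 hV).1).2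
    have h := sum_supersets_zeta_iter hp V j
    rw [hVc, ← hj] at h
    have hf : (j.factorial : ℝ) ≠ 0 := by positivity
    rw [div_mul_eq_mul_div, eq_div_iff hf, mul_comm, ← hVc]
    rw [← hVc] at h
    exact_mod_cast h
  rw [sum_congr rfl hinner, ← mul_sum, closedSum_zeta_eq_zero_of_odd hinv hfix hk hp a, mul_zero]

/-- **Even degrees: the `E`-basis singular profile.** For `π` a fixed-point-free involution of `Fin n`, `p` harmonic of
degree `2κ` (`4κ ≤ n`), `κ ≤ a`, `t = 2a + j`:
`j! · Σ_{|U| = t} C(e_π(U), a) · zeta p (U) = Π_{i<j} (n − 2a − 2κ − i) · C(n/2 − 2κ, a − κ) · Σ_{T closed, |T| = 2κ} p_T`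
(i.e. the coefficient is `C(n − 2a − 2κ, j) · C(n/2 − 2κ, a − κ)` whenever `n ≥ 2a + 2κ + j`). -/
theorem momentSum_zeta_eq_of_even {π : Fin n → Fin n} (hinv : ∀ x, π (π x) = x) (hfix : ∀ x, π x ≠ x)
    {κ : ℕ} (hκn : 4 * κ ≤ n) {p : Finset (Fin n) → ℝ} (hp : IsHarmonic (2 * κ) p) {a j : ℕ} (hκa : κ ≤ a) :
    ((j.factorial : ℕ) : ℝ) * ∑ U ∈ powersetCard (2 * a + j) (univ : Finset (Fin n)),
        ((((U.filter fun x => x < π x ∧ π x ∈ U).card).choose a : ℕ) : ℝ) * zeta p U =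
      (∏ i ∈ range j, ((n : ℝ) - (2 * a : ℕ) - (2 * κ : ℕ) - i)) *
        ((((((univ : Finset (Fin n)).filter fun x => x < π x).card - 2 * κ).choose (a - κ) : ℕ) : ℝ) *
          ∑ T ∈ univ.filter (fun T : Finset (Fin n) => (T.filter fun x => π x ∈ T).card = 2 * κ), p T) := by
  rw [momentSum_eq_closedSum_supersets hinv hfix, mul_sum]
  have hinner : ∀ V ∈ (powersetCard (2 * a) (univ : Finset (Fin n))).filter (fun V => ∀ x ∈ V, π x ∈ V),
      ((j.factorial : ℕ) : ℝ) * ∑ U ∈ (powersetCard (2 * a + j) (univ : Finset (Fin n))).filter (fun U => V ⊆ U),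
        zeta p U = (∏ i ∈ range j, ((n : ℝ) - (2 * a : ℕ) - (2 * κ : ℕ) - i)) * zeta p V := by
    intro V hV
    have hVc : V.card = 2 * a := (mem_powersetCard.1 (mem_filter.1 hV).1).2
    have h := sum_supersets_zeta_iter hp V j
    rw [hVc] at h
    exact_mod_cast h
  rw [sum_congr rfl hinner, ← mul_sum, closedSum_zeta_eq_of_even hinv hfix hκn hp hκa]

end Summit.PneNP.PneNP.Theorems.ChebyshevTracialDesignBinomialMomentSums
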